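import Summits.Ventures.YMGap.RobustBall.StarChartMember
import Summits.Ventures.YMGap.RobustBall.PerturbedCollar
import Summits.Ventures.YMGap.Thresholds.ZdStarWindowTransfer
import HarnessLib

/-!
# Venture YMGap, track ROBUST-BALL (Y2) — crux Y2-X2-Zd, step 4: the `ℤ^d` kernel of a member at a
# periodic boundary condition IS the torus kernel of its chart member; window-contraction transfer

HONEST FRAMING. WHAT THIS IS: a venture file (cell `pub-ymgap`, track Y2 ROBUST-BALL, seat ds-2); an
identity between two finite-volume Gibbs kernels and its one consequence, no estimate of its own. For a
link potential `W` on `ℤ^d` (continuous gauge-invariant terms reading their own links, support family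
`supp`) and a finite volume `Λ`, the perturbed kernel `perturbedYM (fundamentalRep (Fin N)) β W supp Λ`
(rb-p1) is the TILT of the Wilson kernel by `−H^W_Λ` (`perturbedYM_eq_tilted`, Mathlib `tilted_tilted`),
and the torus kernel of the chart member `chartMember L S W …` of an ACTIVE FAMILY `S` of `Λ` (the listed sets
meeting `Λ` with a nonzero term; `StarChartMember.lean`) is the tilt of the torus Wilson kernel by minus its
total, which is `H^W_Λ ∘ torusLift L` (`perturbedTorusSpec_eq_tilted`, `hamiltonianIn_eq_sum_of_active`). Hence ds-1's kernel transfer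
`KernelTransfer.integral_ymSpecification_torusLift_eq_wilson` (Wilson kernels, periodic boundary
condition, `mod L` injective near `Λ`) gives the PERTURBED KERNEL TRANSFER
`integral_perturbedYM_torusLift_eq`, and — verbatim along ds-1's `window_contraction_of_torus` — the
WINDOW-CONTRACTION TRANSFER `perturbed_window_contraction_of_torus`: a one-link Dobrushin–Shlosman window
contraction of the chart member's torus kernel of `Λ.image (torusEdge L)` pulls back to the same
contraction of the member's `ℤ^d` kernel of `Λ`. WHAT THIS IS NOT: no array, no received sum, no
clustering statement; nothing about the continuum or the Millennium problem.

## References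
* H.-O. Georgii (2011) Def. 2.9, (2.15); S. Friedli, Y. Velenik (2017) Lemma 6.7 and the remark on periodic
  boundary conditions before Ex. 6.14.
* The tree: `Thresholds/ZdTorusKernelTransfer.lean`, `Thresholds/ZdStarWindowTransfer.lean` (ds-1, followed
  line by line), `RobustBall/PerturbedCollar.lean` (quasilocality with the `W`-collar), `StarChartMember.lean`.
-/

noncomputable section

open MeasureTheory Finset Function
open Literature.Probability.LatticeModels Literature.Probability.LatticeModels.DobrushinMetric
open Literature.MathematicalPhysics.QuantumLattice hiding torusNorm
open Literature.MathematicalPhysics.QuantumFieldTheory hiding ZdEdge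
open Literature.MathematicalPhysics.QuantumFieldTheory.Balaban1983to89.StrongCouplingTorusWindow
  (wilsonPlaqWeight continuous_wilsonPlaqWeight wilsonPlaqWeight_pos specAvg)
open Summit.Ventures.YMGap.KernelTransfer

namespace Summit.Ventures.YMGap.RobustBall

variable {d L N : ℕ}

/-! ### Active families of a volume -/

/-- **The finite-volume Hamiltonian is the sum over any ACTIVE FAMILY of the volume**: a finite family `S` of
link sets consisting exactly of the listed sets of `supp Λ` meeting `Λ` with a nonzero term (the inactive listed
sets contribute `0`). Stated for an arbitrary `S` with this membership characterisation, so that no decidability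
of `W X ≠ 0` enters the statement. [folklore] -/
theorem hamiltonianIn_eq_sum_of_active (W : Potential (ZdEdge d) (SUN N))
    (supp : Finset (ZdEdge d) → Finset (Finset (ZdEdge d))) (Λ : Finset (ZdEdge d))
    {S : Finset (Finset (ZdEdge d))} (hS : ∀ X, X ∈ S ↔ X ∈ supp Λ ∧ (X ∩ Λ).Nonempty ∧ W X ≠ 0)
    (U : LGConfig d (SUN N)) : hamiltonianIn W supp Λ U = ∑ X ∈ S, W X U := by
  classical
  unfold hamiltonianIn
  symm
  refine Finset.sum_subset (fun X hX => ?_) (fun X hX hXS => ?_)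
  · obtain ⟨h1, h2, -⟩ := (hS X).1 hX
    exact Finset.mem_filter.2 ⟨h1, h2⟩
  · obtain ⟨h1, h2⟩ := Finset.mem_filter.1 hX
    by_contra h0
    exact hXS ((hS X).2 ⟨h1, h2, fun h => h0 (by rw [h]; rfl)⟩)

/-! ### Both kernels are tilts of the Wilson kernels -/

/-- Integration against a tilted measure as a ratio: `∫ F d(μ.tilted g) = (∫ e^{g} F dμ)/(∫ e^{g} dμ)`. [folklore] -/
theorem integral_tilted_eq_div {α : Type*} [MeasurableSpace α] (μ : Measure α) (g F : α → ℝ) :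
    ∫ x, F x ∂(μ.tilted g) = (∫ x, Real.exp (g x) * F x ∂μ) / ∫ x, Real.exp (g x) ∂μ := by
  rw [integral_tilted, ← integral_div]
  refine integral_congr_ae (ae_of_all _ fun x => ?_)
  simp only [smul_eq_mul]
  ring

/-- **The perturbed `ℤ^d` kernel is the tilt of the Wilson kernel by `−H^W_Λ`** (Mathlib `tilted_tilted`;
the Wilson density `e^{−β S_Λ}` is bounded on the compact configuration space). [folklore] -/
theorem perturbedYM_eq_tilted {G : Type*} [Group G] [TopologicalSpace G] [IsTopologicalGroup G]
    [CompactSpace G] [MeasurableSpace G] [BorelSpace G] [SecondCountableTopology G]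
    (ρ : G →* Matrix (Fin N) (Fin N) ℂ)
    (hρ : Continuous ρ) (β : ℝ) (W : Potential (ZdEdge d) G)
    (supp : Finset (ZdEdge d) → Finset (Finset (ZdEdge d))) (Λ : Finset (ZdEdge d)) (η : LGConfig d G) :
    perturbedYM ρ β W supp Λ η =
      (ymSpecification ρ β Λ η).tilted fun U => -hamiltonianIn W supp Λ U := by
  have hc : Continuous fun U : LGConfig d G => Real.exp (-β * wilsonBoundaryAction ρ Λ U) :=
    Real.continuous_exp.comp (continuous_const.mul (continuous_wilsonBoundaryAction ρ hρ Λ))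
  obtain ⟨C, hC⟩ := exists_bound_of_continuous hc
  haveI : IsProbabilityMeasure (((Measure.pi fun _ : ↥Λ => haarProbability G)).map (glueWith Λ · η)) :=
    Measure.isProbabilityMeasure_map (measurable_glueWith Λ η).aemeasurable
  have hint : Integrable (fun U : LGConfig d G => Real.exp (-β * wilsonBoundaryAction ρ Λ U))
      (((Measure.pi fun _ : ↥Λ => haarProbability G)).map (glueWith Λ · η)) :=
    integrable_of_abs_le' hc.measurable hC
  unfold perturbedYM ymSpecification
  -- the energies agree definitionally (`a - b = a + (-b)`)
  rw [tilted_tilted hint]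
  rfl

variable [NeZero L]

/-- **The perturbed torus kernel is the tilt of the torus Wilson kernel by minus the total** of the
perturbation. [folklore] -/
theorem perturbedTorusSpec_eq_tilted (W' : Perturbation d L N) (β : ℝ) (Λ' : Finset (Edge d L))
    (V : GaugeConfig d L (SUN N)) :
    perturbedTorusSpec W' β Λ' V =
      (torusWeightSpec (wilsonPlaqWeight N β) Λ' V).tilted fun U => -W'.total U := by
  have hc : Continuous fun U : GaugeConfig d L (SUN N) =>
      Real.exp (torusLogWeight (wilsonPlaqWeight N β) U) :=
    Real.continuous_exp.comp
      (continuous_torusLogWeight (continuous_wilsonPlaqWeight (N := N) β) (wilsonPlaqWeight_pos β))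
  obtain ⟨C, hC⟩ := exists_bound_of_continuous hc
  haveI : IsProbabilityMeasure
      (((Measure.pi fun _ : ↥Λ' => haarProbability (SUN N))).map (glueWith Λ' · V)) :=
    Measure.isProbabilityMeasure_map (measurable_glueWith Λ' V).aemeasurable
  have hint : Integrable (fun U : GaugeConfig d L (SUN N) => Real.exp (torusLogWeight (wilsonPlaqWeight N β) U))
      (((Measure.pi fun _ : ↥Λ' => haarProbability (SUN N))).map (glueWith Λ' · V)) :=
    integrable_of_abs_le' hc.measurable hC
  unfold perturbedTorusSpec torusWeightSpec
  rw [tilted_tilted hint]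
  rfl

/-! ### The kernel transfer through the chart member of an active family -/

section Transfer

variable {β : ℝ} {W : Potential (ZdEdge d) (SUN N)}
  (hWdep : ∀ X, DependsOn (W X) (↑X : Set (ZdEdge d))) (hg : ∀ X, IsZdGaugeInvariant (W X))
  (hm : ∀ X, Measurable (W X)) (hb : ∀ X, ∃ C, ∀ U, |W X U| ≤ C)
  {supp : Finset (ZdEdge d) → Finset (Finset (ZdEdge d))}

/-- **PERTURBED KERNEL TRANSFER `ℤ^d ↔ (ℤ/L)^d`.** Let `F` be a measurable observable reading the finite
link set `S₀`, `Λ` a finite volume, and `L` so large that reduction mod `L` is injective on the base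
points of `Λ`, `S₀`, the `W`-collar `⋃_{e ∈ Λ} perturbedNbr supp e` and the plaquette collar of `Λ`. Then
for EVERY torus configuration `V`, the member's `ℤ^d` kernel of `Λ` at the periodic boundary condition
`torusLift L V`, applied to `F`, equals the torus kernel of the CHART MEMBER of an active family `S` of `Λ`, of the
projected volume at `V`, applied to `F ∘ torusLift L`. (Both kernels are tilts of the Wilson kernels by
`−H^W_Λ`, resp. `−H^W_Λ ∘ torusLift`; ds-1's Wilson kernel transfer applied to `e^{−H} F` and `e^{−H}`.)
[folklore] -/
theorem integral_perturbedYM_torusLift_eq (hsupp : W.IsSupportedBy supp) (Λ : Finset (ZdEdge d))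
    {S : Finset (Finset (ZdEdge d))} (hS : ∀ X, X ∈ S ↔ X ∈ supp Λ ∧ (X ∩ Λ).Nonempty ∧ W X ≠ 0)
    {F : LGConfig d (SUN N) → ℝ} (hF : Measurable F) {S₀ : Finset (ZdEdge d)}
    (hFS : DependsOn F (↑S₀ : Set (ZdEdge d)))
    (hL : Set.InjOn (Torus.proj L)
      ((Λ ∪ (S₀ ∪ (Λ ∪ Λ.biUnion (perturbedNbr supp))) ∪ (plaquettesTouching Λ).biUnion plaquetteEdges).image
        Prod.fst : Set (Literature.Probability.LatticeModels.Site d)))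
    (V : GaugeConfig d L (SUN N)) :
    ∫ U, F U ∂(perturbedYM (d := d) (fundamentalRep (Fin N)) β W supp Λ (torusLift L V)) =
      ∫ U, toTorusObservable L F U
        ∂(perturbedTorusSpec (chartMember L S W hWdep hg hm hb) β (Λ.image (torusEdge L)) V) := by
  classical
  haveI : SecondCountableTopology (Matrix (Fin N) (Fin N) ℂ) :=
    inferInstanceAs (SecondCountableTopology (Fin N → Fin N → ℂ))
  haveI : SecondCountableTopology (SUN N) := Topology.IsEmbedding.subtypeVal.secondCountableTopology
  set H : LGConfig d (SUN N) → ℝ := hamiltonianIn W supp Λ with hH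
  have hHm : Measurable H := measurable_hamiltonianIn hm supp Λ
  have hHdep : DependsOn H (↑(S₀ ∪ (Λ ∪ Λ.biUnion (perturbedNbr supp))) : Set (ZdEdge d)) :=
    (dependsOn_hamiltonianIn_collar hWdep hsupp Λ).mono fun e he =>
      Finset.mem_coe.2 (Finset.mem_union_right _ (Finset.mem_coe.1 he))
  have hFS' : DependsOn F (↑(S₀ ∪ (Λ ∪ Λ.biUnion (perturbedNbr supp))) : Set (ZdEdge d)) :=
    hFS.mono fun e he => Finset.mem_coe.2 (Finset.mem_union_left _ (Finset.mem_coe.1 he))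
  -- the two observables transported by ds-1's Wilson kernel transfer
  have hΦ₁m : Measurable fun U => Real.exp (-H U) * F U := (Real.measurable_exp.comp hHm.neg).mul hF
  have hΦ₂m : Measurable fun U => Real.exp (-H U) := Real.measurable_exp.comp hHm.neg
  have hΦ₁dep : DependsOn (fun U => Real.exp (-H U) * F U)
      (↑(S₀ ∪ (Λ ∪ Λ.biUnion (perturbedNbr supp))) : Set (ZdEdge d)) := fun U U' h => by
    simp only [hHdep h, hFS' h]
  have hΦ₂dep : DependsOn (fun U => Real.exp (-H U))
      (↑(S₀ ∪ (Λ ∪ Λ.biUnion (perturbedNbr supp))) : Set (ZdEdge d)) := fun U U' h => by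
    simp only [hHdep h]
  have h1 := integral_ymSpecification_torusLift_eq_wilson (β := β) Λ hΦ₁m hΦ₁dep hL V
  have h2 := integral_ymSpecification_torusLift_eq_wilson (β := β) Λ hΦ₂m hΦ₂dep hL V
  -- the total of the chart member is `H ∘ torusLift`
  have htot : ∀ U, (chartMember L S W hWdep hg hm hb).total U = H (torusLift L U) := fun U => by
    rw [total_chartMember, hH, hamiltonianIn_eq_sum_of_active W supp Λ hS]
  rw [perturbedYM_eq_tilted _ continuous_subtype_val, integral_tilted_eq_div, perturbedTorusSpec_eq_tilted,
    integral_tilted_eq_div, h1, h2]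
  simp only [toTorusObservable_apply, htot]

/-- **WINDOW-CONTRACTION TRANSFER for the perturbed kernels** (ds-1's `window_contraction_of_torus`, with
the Wilson kernels replaced by the member's kernel and its chart member's). Let `Λ` be a finite volume, `y`
a link, and `L` such that reduction mod `L` is injective on the base points of `y`, `Λ`, the `W`-collar and
the plaquette collar of `Λ`. If the TORUS kernel of the chart member (of an active family `S` of `Λ`) of the projected volume
`Λ' = Λ.image (torusEdge L)` contracts in the one link `torusEdge L y` with an array `k'` — for all torus
configurations `V, V'` equal off it and all bounded measurable `f'` reading only `Λ'` with per-link
Lipschitz vector `δ' ≥ 0` for a weight `r` — then the member's `ℤ^d` kernel of `Λ` contracts in `y` with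
the pulled-back array `x ↦ k' (torusEdge L x)`. [folklore] -/
theorem perturbed_window_contraction_of_torus (hsupp : W.IsSupportedBy supp) {r : SUN N → SUN N → ℝ}
    (Λ : Finset (ZdEdge d)) {S : Finset (Finset (ZdEdge d))}
    (hS : ∀ X, X ∈ S ↔ X ∈ supp Λ ∧ (X ∩ Λ).Nonempty ∧ W X ≠ 0) {y : ZdEdge d}
    (hL : Set.InjOn (Torus.proj L)
      ((insert y ((Λ ∪ Λ.biUnion (perturbedNbr supp)) ∪ (plaquettesTouching Λ).biUnion plaquetteEdges)).image
        Prod.fst : Set (Literature.Probability.LatticeModels.Site d)))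
    {k' : Edge d L → ℝ}
    (hT : ∀ (V V' : GaugeConfig d L (SUN N)), (∀ e', e' ≠ torusEdge L y → V e' = V' e') →
      ∀ (f' : GaugeConfig d L (SUN N) → ℝ) (δ' : Edge d L → ℝ),
        Measurable f' → (∃ B, ∀ U, |f' U| ≤ B) →
        DependsOn f' (↑(Λ.image (torusEdge L)) : Set (Edge d L)) → (∀ x', 0 ≤ δ' x') →
        (∀ (x' : Edge d L) (U U' : GaugeConfig d L (SUN N)),
          (∀ e', e' ≠ x' → U e' = U' e') → |f' U - f' U'| ≤ δ' x' * r (U x') (U' x')) →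
        |∫ U, f' U ∂(perturbedTorusSpec (chartMember L S W hWdep hg hm hb) β (Λ.image (torusEdge L)) V) -
            ∫ U, f' U ∂(perturbedTorusSpec (chartMember L S W hWdep hg hm hb) β (Λ.image (torusEdge L)) V')| ≤
          (∑ x' ∈ Λ.image (torusEdge L), k' x' * δ' x') * r (V (torusEdge L y)) (V' (torusEdge L y)))
    {σ σ' : LGConfig d (SUN N)} (hσ : ∀ e, e ≠ y → σ e = σ' e)
    {f : LGConfig d (SUN N) → ℝ} (hfm : Measurable f) (hfb : ∃ B, ∀ U, |f U| ≤ B)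
    (hfdep : DependsOn f (↑Λ : Set (ZdEdge d))) {δ : ZdEdge d → ℝ} (hδ0 : ∀ e, 0 ≤ δ e)
    (hlip : ∀ (e : ZdEdge d) (τ τ' : LGConfig d (SUN N)), (∀ e', e' ≠ e → τ e' = τ' e') →
      |f τ - f τ'| ≤ δ e * r (τ e) (τ' e)) :
    |∫ U, f U ∂(perturbedYM (d := d) (fundamentalRep (Fin N)) β W supp Λ σ) -
        ∫ U, f U ∂(perturbedYM (d := d) (fundamentalRep (Fin N)) β W supp Λ σ')| ≤
      (∑ x ∈ Λ, k' (torusEdge L x) * δ x) * r (σ y) (σ' y) := by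
  classical
  haveI : SecondCountableTopology (Matrix (Fin N) (Fin N) ℂ) :=
    inferInstanceAs (SecondCountableTopology (Fin N → Fin N → ℂ))
  haveI : SecondCountableTopology (SUN N) := Topology.IsEmbedding.subtypeVal.secondCountableTopology
  -- the edge set on which everything is read, and injectivity there
  set T : Finset (ZdEdge d) :=
    insert y ((Λ ∪ Λ.biUnion (perturbedNbr supp)) ∪ (plaquettesTouching Λ).biUnion plaquetteEdges) with hTdef
  have hTinj : Set.InjOn (torusEdge (d := d) L) ↑T := injOn_torusEdge hL
  have hyT : y ∈ T := Finset.mem_insert_self _ _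
  have hΛT : Λ ⊆ T := fun e he =>
    Finset.mem_insert_of_mem (Finset.mem_union_left _ (Finset.mem_union_left _ he))
  have hΛinj : Set.InjOn (torusEdge (d := d) L) ↑Λ := hTinj.mono (Finset.coe_subset.2 hΛT)
  have hL' : Set.InjOn (Torus.proj L)
      ((Λ ∪ (Λ ∪ (Λ ∪ Λ.biUnion (perturbedNbr supp))) ∪ (plaquettesTouching Λ).biUnion plaquetteEdges).image
        Prod.fst : Set (Literature.Probability.LatticeModels.Site d)) := by
    refine hL.mono (Finset.coe_subset.2 (Finset.image_subset_image ?_))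
    intro e he
    rw [hTdef, Finset.mem_insert, Finset.mem_union, Finset.mem_union]
    simp only [Finset.mem_union] at he
    tauto
  -- lift the two boundary data to the torus; they differ only at `torusEdge L y`
  obtain ⟨V, hV⟩ := exists_torusLift_eqOn (G := SUN N) hTinj σ
  set V' : GaugeConfig d L (SUN N) := Function.update V (torusEdge L y) (σ' y) with hV'def
  have hV' : ∀ e ∈ T, torusLift L V' e = σ' e :=
    torusLift_update_eqOn hTinj hyT (fun e he => (hσ e he).symm) hV
  have hVV' : ∀ e', e' ≠ torusEdge L y → V e' = V' e' := fun e' h => (update_eq_off V y (σ' y) e' h).symm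
  -- the member's `ℤ^d` kernel reads the boundary condition only on the `W`-collar `⊆ T`
  have hker := dependsOn_specAvg_perturbedYM_collar (fundamentalRep (Fin N)) continuous_subtype_val β
    hm hWdep hsupp Λ hfm hfdep
  have hread : ∀ {ξ : LGConfig d (SUN N)} {U : GaugeConfig d L (SUN N)},
      (∀ e ∈ T, torusLift L U e = ξ e) →
      ∫ τ, f τ ∂(perturbedYM (d := d) (fundamentalRep (Fin N)) β W supp Λ ξ) =
        ∫ τ, f τ ∂(perturbedYM (d := d) (fundamentalRep (Fin N)) β W supp Λ (torusLift L U)) := by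
    intro ξ U hU
    refine hker fun e he => ?_
    have heT : e ∈ T := Finset.mem_insert_of_mem (Finset.mem_union_left _ (Finset.mem_coe.1 he))
    exact (hU e heT).symm
  rw [hread hV, hread hV',
    integral_perturbedYM_torusLift_eq hWdep hg hm hb hsupp Λ hS hfm hfdep hL' V,
    integral_perturbedYM_torusLift_eq hWdep hg hm hb hsupp Λ hS hfm hfdep hL' V']
  -- the transported observable and its Lipschitz vector
  set δ' : Edge d L → ℝ := fun x' => ∑ e ∈ Λ.filter (fun e => torusEdge L e = x'), δ e with hδ'def
  have h := hT V V' hVV' (toTorusObservable L f) δ' (hfm.comp (continuous_torusLift L).measurable)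
    (hfb.imp fun B hB U => hB _) (dependsOn_toTorusObservable hfdep)
    (fun x' => lipVec_toTorus_nonneg hδ0 x')
    (fun x' U U' hUU' => lip_toTorusObservable hfdep hΛinj hlip x' U U' hUU')
  -- read the bound back on `ℤ^d`
  have hy1 : V (torusEdge L y) = σ y := by simpa [torusLift] using hV y hyT
  have hy2 : V' (torusEdge L y) = σ' y := by simpa [torusLift] using hV' y hyT
  rw [hy1, hy2, hδ'def, sum_image_lipVec_toTorus δ k'] at h
  exact h

end Transfer

end Summit.Ventures.YMGap.RobustBall

end
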